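import Summits.ResolutionOfSingularities.ResolutionOfSingularities.Theorems.FrobeniusLadderFInjectiveMacaulayficationWeightedConeCore
import Summits.ResolutionOfSingularities.ResolutionOfSingularities.Theorems.FrobeniusLadderFInjectiveMacaulayficationE8WeightedData
import Summits.ResolutionOfSingularities.ResolutionOfSingularities.Theorems.FrobeniusLadderFInjectiveMacaulayficationE8Forms
import Summits.ResolutionOfSingularities.ResolutionOfSingularities.Theorems.FrobeniusLadderFInjectiveMacaulayficationPrimeTransfer
import Summits.ResolutionOfSingularities.ResolutionOfSingularities.Theorems.FrobeniusLadderFInjectiveMacaulayficationThreefoldNotDvd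
import HarnessLib

/-!
# The graded engine G5 and the `E₈⁰` calibration G6 as consequences of the graded chart clause G4
(crux `FInjectiveMacaulayfication`, line `graded-engine`, §16)

[OURS · L1 W4.5a] Support file for crux stmt-ResolutionOfSingularities-15315
(`Summit.ResolutionOfSingularities.ResolutionOfSingularities.Theses.FrobeniusLadder.FInjectiveMacaulayfication`,
route `FrobeniusLadder`, registered skeleton v11 `86e9127b5c98b8e6`, line `graded-engine`).  The skeleton's §16 registers
three stubs: G4 `stub_gradedChartClause` (OPEN — being assembled from the landed helpers H-G1…H-G4b), G5
`stub_gradedConeFiModel` and G6 `stub_e8GradedFiModel`, the last two PROVED IN THE SKELETON modulo G4 (lead seat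
res-L1-w45a-lead-1, design memo GRADED-ENGINE.md v2).  This file lands those two in-skeleton proofs as IMPLICATIONS with
the registered signatures verbatim on both sides, so that the moment G4 lands the registered G5 and G6 are one-liners
(`gradedConeFiModel_of_gradedChartClause stub_gradedChartClause`, `e8GradedFiModel_of_gradedChartClause
stub_gradedChartClause`) independently of which seat is present:

* `gradedConeFiModel_of_gradedChartClause : ⟨G4⟩ → ⟨G5⟩` — the landed core
  `WeightedConeCore.weightedConeFiModel_of_chartClause` (p460946) needs exactly the chart clause G4 at every chart
  `v` (with `c v > 0` from `c v * w v = N > 0`);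
* `e8_X_ne_zero` — no variable lies in `(X₂² + X₀³ + X₁⁵)` (evaluation at a point with `X_v = 0`, `f = 1`);
* `e8GradedFiModel_of_gradedConeFiModel : ⟨G5⟩ → ⟨G6⟩` and `e8GradedFiModel_of_gradedChartClause : ⟨G4⟩ → ⟨G6⟩` —
  `E₈⁰` in ONE `(10,6,15)`-weighted blow-up (`N = 30`, `c = (3,5,2)`) at `p = 2, 3, 5`: homogeneity, Veronese splitting and the
  off-origin clause from `E8WeightedData` (p466953), primality from `E8Forms` (p137855).

Proofs are the lead's in-skeleton proofs, moved verbatim (adapted from `Cruxes/…/Lines` skeleton v11 §16).  No definition is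
declared; no statement of [claim: Hironaka2017] is used; AI-written, weaker than expert review. [folklore]
-/

-- single-problem summit: the doubled namespace component `ResolutionOfSingularities` is forced
set_option linter.dupNamespace false

noncomputable section

open CategoryTheory AlgebraicGeometry
open Literature.AlgebraicGeometry.Resolution
open Summit.ResolutionOfSingularities.ResolutionOfSingularities.Theorems.FInjectiveMacaulayfication

namespace Summit.ResolutionOfSingularities.ResolutionOfSingularities.Theorems.FInjectiveMacaulayfication.GradedEngineOfChartClause

/-- **G5 from G4** (registered signatures verbatim on both sides): if the graded chart clause G4 holds, then for `f`
weighted-homogeneous prime with all `x̄_v ≠ 0`, `N = c_v·w_v` with Veronese saturation and the clause off the origin,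
`affineBlowup (I_N R)` is an F-injective Macaulayfication of `Spec R` at every `p` — the landed core
`WeightedConeCore.weightedConeFiModel_of_chartClause` composed with G4 chart by chart. [folklore] -/
-- adapted from the registered skeleton v11 §16 (`stub_gradedConeFiModel`, lead res-L1-w45a-lead-1)
theorem gradedConeFiModel_of_gradedChartClause
    (hG4 : ∀ (p : ℕ) [Fact p.Prime] (k : Type) [Field k] [CharP k p] (n : ℕ) (w : Fin n → ℕ) (v : Fin n),
    0 < w v → ∀ (N c D : ℕ), c * w v = N → 0 < c →
    (∀ (K : ℕ) (b : Fin n →₀ ℕ), K * N ≤ Finsupp.weight w b → (MvPolynomial.monomial b (1 : k) : MvPolynomial (Fin n) k) ∈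
      (Ideal.span {m : MvPolynomial (Fin n) k | ∃ b : Fin n →₀ ℕ, N ≤ Finsupp.weight w b ∧ m = MvPolynomial.monomial b 1}) ^ K) →
    ∀ (f : MvPolynomial (Fin n) k), MvPolynomial.IsWeightedHomogeneous w f D → (Ideal.span {f}).IsPrime →
    (∀ j : Fin n, Ideal.Quotient.mk (Ideal.span {f}) (MvPolynomial.X j) ≠ 0) →
    (∀ (Q : Ideal (MvPolynomial (Fin n) k ⧸ Ideal.span {f})) [Q.IsMaximal],
      (∃ j : Fin n, Ideal.Quotient.mk (Ideal.span {f}) (MvPolynomial.X j) ∉ Q) →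
      ∀ d : ℕ, ringKrullDim (Localization.AtPrime Q) = d → ∀ s : Fin d → Localization.AtPrime Q,
        (Ideal.span (Set.range s)).radical.IsMaximal →
          RingTheory.Sequence.IsWeaklyRegular (Localization.AtPrime Q) (List.ofFn s) ∧
          ∀ y : Localization.AtPrime Q, (∃ e : ℕ, y ^ p ^ e ∈ Ideal.span
            ((fun z : Localization.AtPrime Q => z ^ p ^ e) ''
              (Ideal.span (Set.range s) : Set (Localization.AtPrime Q)))) → y ∈ Ideal.span (Set.range s)) →
    ∀ (Q : Ideal (blowupAlgebra ((Ideal.span {m : MvPolynomial (Fin n) k | ∃ b : Fin n →₀ ℕ, N ≤ Finsupp.weight w b ∧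
        m = MvPolynomial.monomial b 1}).map (Ideal.Quotient.mk (Ideal.span {f}))) (Ideal.Quotient.mk (Ideal.span {f}) (MvPolynomial.X v) ^ c)))
      [Q.IsMaximal],
      algebraMap (MvPolynomial (Fin n) k ⧸ Ideal.span {f}) (blowupAlgebra ((Ideal.span {m : MvPolynomial (Fin n) k | ∃ b : Fin n →₀ ℕ,
        N ≤ Finsupp.weight w b ∧ m = MvPolynomial.monomial b 1}).map (Ideal.Quotient.mk (Ideal.span {f})))
          (Ideal.Quotient.mk (Ideal.span {f}) (MvPolynomial.X v) ^ c)) (Ideal.Quotient.mk (Ideal.span {f}) (MvPolynomial.X v) ^ c) ∈ Q →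
      ∀ d : ℕ, ringKrullDim (Localization.AtPrime Q) = d → ∀ s : Fin d → Localization.AtPrime Q,
        (Ideal.span (Set.range s)).radical.IsMaximal →
          RingTheory.Sequence.IsWeaklyRegular (Localization.AtPrime Q) (List.ofFn s) ∧
          ∀ y : Localization.AtPrime Q, (∃ e : ℕ, y ^ p ^ e ∈ Ideal.span
            ((fun z : Localization.AtPrime Q => z ^ p ^ e) ''
              (Ideal.span (Set.range s) : Set (Localization.AtPrime Q)))) → y ∈ Ideal.span (Set.range s)) :
    ∀ (p : ℕ) [Fact p.Prime] (k : Type) [Field k] [CharP k p] (n : ℕ) (w : Fin n → ℕ) (N D : ℕ)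
    (c : Fin n → ℕ), 0 < N → (∀ v : Fin n, 0 < w v ∧ c v * w v = N) →
    (∀ (K : ℕ) (b : Fin n →₀ ℕ), K * N ≤ Finsupp.weight w b → (MvPolynomial.monomial b (1 : k) : MvPolynomial (Fin n) k) ∈
      (Ideal.span {m : MvPolynomial (Fin n) k | ∃ b : Fin n →₀ ℕ, N ≤ Finsupp.weight w b ∧ m = MvPolynomial.monomial b 1}) ^ K) →
    ∀ (f : MvPolynomial (Fin n) k), MvPolynomial.IsWeightedHomogeneous w f D → (Ideal.span {f}).IsPrime →
    (∀ v : Fin n, Ideal.Quotient.mk (Ideal.span {f}) (MvPolynomial.X v) ≠ 0) →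
    (∀ (Q : Ideal (MvPolynomial (Fin n) k ⧸ Ideal.span {f})) [Q.IsMaximal],
      (∃ j : Fin n, Ideal.Quotient.mk (Ideal.span {f}) (MvPolynomial.X j) ∉ Q) →
      ∀ d : ℕ, ringKrullDim (Localization.AtPrime Q) = d → ∀ s : Fin d → Localization.AtPrime Q,
        (Ideal.span (Set.range s)).radical.IsMaximal →
          RingTheory.Sequence.IsWeaklyRegular (Localization.AtPrime Q) (List.ofFn s) ∧
          ∀ y : Localization.AtPrime Q, (∃ e : ℕ, y ^ p ^ e ∈ Ideal.span
            ((fun z : Localization.AtPrime Q => z ^ p ^ e) ''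
              (Ideal.span (Set.range s) : Set (Localization.AtPrime Q)))) → y ∈ Ideal.span (Set.range s)) →
    ∃ (X' : Scheme.{0}) (π : X' ⟶ Spec (.of (MvPolynomial (Fin n) k ⧸ Ideal.span {f}))), IsProper π ∧
      Literature.AlgebraicGeometry.Resolution.IsBirational π ∧
      ∀ y : X', IsDomain (X'.presheaf.stalk y) ∧ ∀ d : ℕ, ringKrullDim (X'.presheaf.stalk y) = d →
        ∀ s : Fin d → X'.presheaf.stalk y, (Ideal.span (Set.range s)).radical.IsMaximal →
          RingTheory.Sequence.IsWeaklyRegular (X'.presheaf.stalk y) (List.ofFn s) ∧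
          ∀ z : X'.presheaf.stalk y, (∃ e : ℕ, z ^ p ^ e ∈
              Ideal.span ((fun w : X'.presheaf.stalk y => w ^ p ^ e) ''
                (Ideal.span (Set.range s) : Set (X'.presheaf.stalk y)))) →
            z ∈ Ideal.span (Set.range s) := by
  intro p _ k _ _ n w N D c hN hwc hpow f hf hfprime hXne hoff
  have hc : ∀ j : Fin n, 0 < c j := fun j => Nat.pos_of_ne_zero fun h => by
    have h2 := (hwc j).2
    rw [h, zero_mul] at h2
    omega
  exact WeightedConeCore.weightedConeFiModel_of_chartClause p k n w N c hN hwc hpow f hfprime hXne hoff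
    (fun v Q _ hQ => hG4 p k n w v (hwc v).1 N (c v) D (hwc v).2 (hc v) hpow f hf hfprime hXne hoff Q hQ)

/-- No variable lies in `(E₈⁰) = (X₂² + X₀³ + X₁⁵)`: evaluate at a point with `X_v = 0` and `f = 1` (`(1,0,0)` for `v ≠ 0`,
`(0,0,1)` for `v = 0`). [folklore] -/
-- adapted from the registered skeleton v11 §16 (`e8_X_ne_zero`)
theorem e8_X_ne_zero (k : Type) [Field k] (f : MvPolynomial (Fin 3) k)
    (hf : f = MvPolynomial.X 2 ^ 2 + MvPolynomial.X 0 ^ 3 + MvPolynomial.X 1 ^ 5) (hprime : (Ideal.span {f}).IsPrime)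
    (v : Fin 3) : Ideal.Quotient.mk (Ideal.span {f}) (MvPolynomial.X v) ≠ 0 := by
  intro h
  refine PrimeTransfer.X_not_mem_span_of_isPrime hprime ?_ (Ideal.Quotient.eq_zero_iff_mem.mp h)
  by_cases hv : v = 0
  · subst hv
    refine ThreefoldNotDvd.not_mem_span_X_of_eval_eq_one 0 ![0, 0, 1] rfl ?_
    subst hf; simp
  · refine ThreefoldNotDvd.not_mem_span_X_of_eval_eq_one v ![1, 0, 0] ?_ ?_
    · fin_cases v <;> simp_all
    · subst hf; simp

/-- **G6 from G5** (registered signatures verbatim on both sides): over every field of characteristic `2`, `3` or `5` the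
surface `X₂² + X₀³ + X₁⁵ = 0` admits the crux's model by the single `(10,6,15)`-weighted blow-up `affineBlowup I₃₀` —
G5 at `n = 3`, `w = (10,6,15)`, `N = D = 30`, `c = (3,5,2)`, with homogeneity / Veronese splitting / off-origin clause from
`E8WeightedData` and primality from `E8Forms`. [folklore] -/
-- adapted from the registered skeleton v11 §16 (`stub_e8GradedFiModel`)
theorem e8GradedFiModel_of_gradedConeFiModel
    (hG5 : ∀ (p : ℕ) [Fact p.Prime] (k : Type) [Field k] [CharP k p] (n : ℕ) (w : Fin n → ℕ) (N D : ℕ)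
    (c : Fin n → ℕ), 0 < N → (∀ v : Fin n, 0 < w v ∧ c v * w v = N) →
    (∀ (K : ℕ) (b : Fin n →₀ ℕ), K * N ≤ Finsupp.weight w b → (MvPolynomial.monomial b (1 : k) : MvPolynomial (Fin n) k) ∈
      (Ideal.span {m : MvPolynomial (Fin n) k | ∃ b : Fin n →₀ ℕ, N ≤ Finsupp.weight w b ∧ m = MvPolynomial.monomial b 1}) ^ K) →
    ∀ (f : MvPolynomial (Fin n) k), MvPolynomial.IsWeightedHomogeneous w f D → (Ideal.span {f}).IsPrime →
    (∀ v : Fin n, Ideal.Quotient.mk (Ideal.span {f}) (MvPolynomial.X v) ≠ 0) →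
    (∀ (Q : Ideal (MvPolynomial (Fin n) k ⧸ Ideal.span {f})) [Q.IsMaximal],
      (∃ j : Fin n, Ideal.Quotient.mk (Ideal.span {f}) (MvPolynomial.X j) ∉ Q) →
      ∀ d : ℕ, ringKrullDim (Localization.AtPrime Q) = d → ∀ s : Fin d → Localization.AtPrime Q,
        (Ideal.span (Set.range s)).radical.IsMaximal →
          RingTheory.Sequence.IsWeaklyRegular (Localization.AtPrime Q) (List.ofFn s) ∧
          ∀ y : Localization.AtPrime Q, (∃ e : ℕ, y ^ p ^ e ∈ Ideal.span
            ((fun z : Localization.AtPrime Q => z ^ p ^ e) ''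
              (Ideal.span (Set.range s) : Set (Localization.AtPrime Q)))) → y ∈ Ideal.span (Set.range s)) →
    ∃ (X' : Scheme.{0}) (π : X' ⟶ Spec (.of (MvPolynomial (Fin n) k ⧸ Ideal.span {f}))), IsProper π ∧
      Literature.AlgebraicGeometry.Resolution.IsBirational π ∧
      ∀ y : X', IsDomain (X'.presheaf.stalk y) ∧ ∀ d : ℕ, ringKrullDim (X'.presheaf.stalk y) = d →
        ∀ s : Fin d → X'.presheaf.stalk y, (Ideal.span (Set.range s)).radical.IsMaximal →
          RingTheory.Sequence.IsWeaklyRegular (X'.presheaf.stalk y) (List.ofFn s) ∧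
          ∀ z : X'.presheaf.stalk y, (∃ e : ℕ, z ^ p ^ e ∈
              Ideal.span ((fun w : X'.presheaf.stalk y => w ^ p ^ e) ''
                (Ideal.span (Set.range s) : Set (X'.presheaf.stalk y)))) →
            z ∈ Ideal.span (Set.range s)) :
    ∀ (p : ℕ) [Fact p.Prime], (p = 2 ∨ p = 3 ∨ p = 5) → ∀ (k : Type) [Field k] [CharP k p]
    (f : MvPolynomial (Fin 3) k), f = MvPolynomial.X 2 ^ 2 + MvPolynomial.X 0 ^ 3 + MvPolynomial.X 1 ^ 5 →
    ∃ (X' : Scheme.{0}) (π : X' ⟶ Spec (.of (MvPolynomial (Fin 3) k ⧸ Ideal.span {f}))), IsProper π ∧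
      Literature.AlgebraicGeometry.Resolution.IsBirational π ∧
      ∀ y : X', IsDomain (X'.presheaf.stalk y) ∧ ∀ d : ℕ, ringKrullDim (X'.presheaf.stalk y) = d →
        ∀ s : Fin d → X'.presheaf.stalk y, (Ideal.span (Set.range s)).radical.IsMaximal →
          RingTheory.Sequence.IsWeaklyRegular (X'.presheaf.stalk y) (List.ofFn s) ∧
          ∀ z : X'.presheaf.stalk y, (∃ e : ℕ, z ^ p ^ e ∈
              Ideal.span ((fun w : X'.presheaf.stalk y => w ^ p ^ e) ''
                (Ideal.span (Set.range s) : Set (X'.presheaf.stalk y)))) →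
            z ∈ Ideal.span (Set.range s) := by
  intro p _ hp k _ _ f hf
  have hprime : (Ideal.span {f}).IsPrime := (E8Forms.stub_e8Forms k f _ _ hf rfl rfl).1.1
  -- the off-origin clause at the three bad primes
  have hoff : ∀ (Q : Ideal (MvPolynomial (Fin 3) k ⧸ Ideal.span {f})) [Q.IsMaximal],
      (∃ j : Fin 3, Ideal.Quotient.mk (Ideal.span {f}) (MvPolynomial.X j) ∉ Q) →
      ∀ d : ℕ, ringKrullDim (Localization.AtPrime Q) = d → ∀ s : Fin d → Localization.AtPrime Q,
        (Ideal.span (Set.range s)).radical.IsMaximal →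
          RingTheory.Sequence.IsWeaklyRegular (Localization.AtPrime Q) (List.ofFn s) ∧
          ∀ y : Localization.AtPrime Q, (∃ e : ℕ, y ^ p ^ e ∈ Ideal.span
            ((fun z : Localization.AtPrime Q => z ^ p ^ e) ''
              (Ideal.span (Set.range s) : Set (Localization.AtPrime Q)))) → y ∈ Ideal.span (Set.range s) := by
    rcases hp with rfl | rfl | rfl
    · exact E8WeightedData.e8_offOrigin_clause_char2 k f hf
    · exact E8WeightedData.e8_offOrigin_clause_char3 k f hf
    · exact E8WeightedData.e8_offOrigin_clause_char5 k f hf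
  refine hG5 p k 3 ![10, 6, 15] 30 30 ![3, 5, 2] (by norm_num) (by decide)
    (E8WeightedData.e8VeroneseSplitting k) f ?_ hprime (e8_X_ne_zero k f hf hprime) hoff
  rw [hf]
  exact E8WeightedData.e8_isWeightedHomogeneous k

/-- **G6 from G4** (registered signatures verbatim): `e8GradedFiModel_of_gradedConeFiModel ∘
gradedConeFiModel_of_gradedChartClause`. [folklore] -/
theorem e8GradedFiModel_of_gradedChartClause
    (hG4 : ∀ (p : ℕ) [Fact p.Prime] (k : Type) [Field k] [CharP k p] (n : ℕ) (w : Fin n → ℕ) (v : Fin n),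
    0 < w v → ∀ (N c D : ℕ), c * w v = N → 0 < c →
    (∀ (K : ℕ) (b : Fin n →₀ ℕ), K * N ≤ Finsupp.weight w b → (MvPolynomial.monomial b (1 : k) : MvPolynomial (Fin n) k) ∈
      (Ideal.span {m : MvPolynomial (Fin n) k | ∃ b : Fin n →₀ ℕ, N ≤ Finsupp.weight w b ∧ m = MvPolynomial.monomial b 1}) ^ K) →
    ∀ (f : MvPolynomial (Fin n) k), MvPolynomial.IsWeightedHomogeneous w f D → (Ideal.span {f}).IsPrime →
    (∀ j : Fin n, Ideal.Quotient.mk (Ideal.span {f}) (MvPolynomial.X j) ≠ 0) →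
    (∀ (Q : Ideal (MvPolynomial (Fin n) k ⧸ Ideal.span {f})) [Q.IsMaximal],
      (∃ j : Fin n, Ideal.Quotient.mk (Ideal.span {f}) (MvPolynomial.X j) ∉ Q) →
      ∀ d : ℕ, ringKrullDim (Localization.AtPrime Q) = d → ∀ s : Fin d → Localization.AtPrime Q,
        (Ideal.span (Set.range s)).radical.IsMaximal →
          RingTheory.Sequence.IsWeaklyRegular (Localization.AtPrime Q) (List.ofFn s) ∧
          ∀ y : Localization.AtPrime Q, (∃ e : ℕ, y ^ p ^ e ∈ Ideal.span
            ((fun z : Localization.AtPrime Q => z ^ p ^ e) ''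
              (Ideal.span (Set.range s) : Set (Localization.AtPrime Q)))) → y ∈ Ideal.span (Set.range s)) →
    ∀ (Q : Ideal (blowupAlgebra ((Ideal.span {m : MvPolynomial (Fin n) k | ∃ b : Fin n →₀ ℕ, N ≤ Finsupp.weight w b ∧
        m = MvPolynomial.monomial b 1}).map (Ideal.Quotient.mk (Ideal.span {f}))) (Ideal.Quotient.mk (Ideal.span {f}) (MvPolynomial.X v) ^ c)))
      [Q.IsMaximal],
      algebraMap (MvPolynomial (Fin n) k ⧸ Ideal.span {f}) (blowupAlgebra ((Ideal.span {m : MvPolynomial (Fin n) k | ∃ b : Fin n →₀ ℕ,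
        N ≤ Finsupp.weight w b ∧ m = MvPolynomial.monomial b 1}).map (Ideal.Quotient.mk (Ideal.span {f})))
          (Ideal.Quotient.mk (Ideal.span {f}) (MvPolynomial.X v) ^ c)) (Ideal.Quotient.mk (Ideal.span {f}) (MvPolynomial.X v) ^ c) ∈ Q →
      ∀ d : ℕ, ringKrullDim (Localization.AtPrime Q) = d → ∀ s : Fin d → Localization.AtPrime Q,
        (Ideal.span (Set.range s)).radical.IsMaximal →
          RingTheory.Sequence.IsWeaklyRegular (Localization.AtPrime Q) (List.ofFn s) ∧
          ∀ y : Localization.AtPrime Q, (∃ e : ℕ, y ^ p ^ e ∈ Ideal.span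
            ((fun z : Localization.AtPrime Q => z ^ p ^ e) ''
              (Ideal.span (Set.range s) : Set (Localization.AtPrime Q)))) → y ∈ Ideal.span (Set.range s)) :
    ∀ (p : ℕ) [Fact p.Prime], (p = 2 ∨ p = 3 ∨ p = 5) → ∀ (k : Type) [Field k] [CharP k p]
    (f : MvPolynomial (Fin 3) k), f = MvPolynomial.X 2 ^ 2 + MvPolynomial.X 0 ^ 3 + MvPolynomial.X 1 ^ 5 →
    ∃ (X' : Scheme.{0}) (π : X' ⟶ Spec (.of (MvPolynomial (Fin 3) k ⧸ Ideal.span {f}))), IsProper π ∧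
      Literature.AlgebraicGeometry.Resolution.IsBirational π ∧
      ∀ y : X', IsDomain (X'.presheaf.stalk y) ∧ ∀ d : ℕ, ringKrullDim (X'.presheaf.stalk y) = d →
        ∀ s : Fin d → X'.presheaf.stalk y, (Ideal.span (Set.range s)).radical.IsMaximal →
          RingTheory.Sequence.IsWeaklyRegular (X'.presheaf.stalk y) (List.ofFn s) ∧
          ∀ z : X'.presheaf.stalk y, (∃ e : ℕ, z ^ p ^ e ∈
              Ideal.span ((fun w : X'.presheaf.stalk y => w ^ p ^ e) ''
                (Ideal.span (Set.range s) : Set (X'.presheaf.stalk y)))) →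
            z ∈ Ideal.span (Set.range s) :=
  e8GradedFiModel_of_gradedConeFiModel (gradedConeFiModel_of_gradedChartClause hG4)

end Summit.ResolutionOfSingularities.ResolutionOfSingularities.Theorems.FInjectiveMacaulayfication.GradedEngineOfChartClause

end
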